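import Literature.Geometry.Lorentzian.RicciChartDecay
import Literature.Geometry.Lorentzian.RicciVariationScalarDecay
import Literature.Geometry.Lorentzian.CoordLaplacianPerturbation
import Mathlib.MeasureTheory.Measure.Lebesgue.VolumeOfBalls
import HarnessLib

/-!
# The coordinate Laplace–Beltrami operator in scalar-coefficient form and the decay of its
# coefficients on an asymptotically flat end

For the linear equation of Schoen–Yau's conformal argument (Comm. Math. Phys. 65 (1979), §3,
Lemma 3.2/3.3 and Cor. 3.1: `Δ_h v − (R/8) v = R/8` on an end with `h = δ + O''(r⁻²)`), the
coordinate Laplace–Beltrami operator `MetricCoord.lapAt` is rewritten as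

  `Δ_G f(x) = Σₖₗ a_{kl}(x) ∂ₗ∂ₖ f(x) + Σₘ βₘ(x) ∂ₘ f(x)`,  `a_{kl} = g^{lk}`,
  `βₘ = -½ Σₖₗⱼ g^{kl} g^{mj} K(bₖ, bₗ, bⱼ)` (`K` the Koszul form)

along an orthonormal basis `b` (`MetricCoord.lapAt_eq_secondOrderOp`), the inverse metric
coefficients are identified with the inverse Gram matrix (`MetricCoord.ginv_eq_inv`), and on an
asymptotically flat end with `h − δ ∈ O_k(r^{−β})` the coefficients are shown to be smooth symbols:
`g^{ij} − δ^{ij} ∈ O_k(r^{−β})`, `βₘ ∈ O_{k}(r^{−β−1})`, `R∘Φ ∈ O_k(r^{−β−2})`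
(`AFEnd.isBigOSmooth_ginv_sub`, `AFEnd.isBigOSmooth_firstOrderCoeff`,
`AFEnd.isBigOSmooth_scalarCurvatureCoeff`). Finally the symbol estimates are turned into the
pointwise bounds, with one constant, on the coefficients and their first two partial derivatives
that the flat decay bootstrap consumes (`AFEnd.exists_chartCoeff_bounds`; Schoen–Yau (1.1) with
`h = δ + O''(r⁻²)`).

## References
* R. Schoen, S.-T. Yau, *On the proof of the positive mass conjecture in general relativity*,
  Comm. Math. Phys. 65 (1979), 45–76, §1 (1.1), §3. [cite: SchoenYauPMT1979]
* B. O'Neill, *Semi-Riemannian geometry*, Academic Press 1983, Ch. 3. [cite: ONeill1983]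
-/

noncomputable section

set_option maxSynthPendingDepth 3

open Bundle Set Function Filter Asymptotics Bornology Topology TopologicalSpace Manifold
open scoped ContDiff Manifold RealInnerProductSpace

namespace Literature.Geometry.Lorentzian

/-! ### The inverse metric coefficients are the inverse Gram matrix -/

namespace MetricCoord

section GramInverse

variable {E : Type*} [NormedAddCommGroup E] [NormedSpace ℝ E] [FiniteDimensional ℝ E]
  {ι : Type*} [Fintype ι] [DecidableEq ι] {G : E → E →L[ℝ] E →L[ℝ] ℝ} (b : Module.Basis ι ℝ E)
  {x : E}

/-- **`g^{ij}` is the inverse of the Gram matrix**: for an invertible symmetric `G x` and any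
basis `b`, `ginv G b x i j = ((G x (bᵢ, bⱼ))ᵢⱼ)⁻¹ i j` (both satisfy `Σⱼ g^{ij} G(bₖ, bⱼ) = δᵢₖ`,
`coord_eq_sum_ginv`). [cite: ONeill1983, Ch. 3, Lemma 3.4] -/
theorem ginv_eq_inv (hx : (G x).IsInvertible) (hs : ∀ v w : E, G x v w = G x w v) (i j : ι) :
    ginv G b x i j = (Matrix.of fun i j => G x (b i) (b j))⁻¹ i j := by
  set A : Matrix ι ι ℝ := Matrix.of fun i j => G x (b i) (b j) with hA
  set B : Matrix ι ι ℝ := Matrix.of fun i j => ginv G b x i j with hB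
  have hBA : B * A = 1 := by
    ext i k
    rw [Matrix.mul_apply, Matrix.one_apply]
    have h := coord_eq_sum_ginv b hx (b k) i
    rw [Module.Basis.coord_apply, b.repr_self, Finsupp.single_apply] at h
    simp only [hA, hB, Matrix.of_apply]
    calc ∑ j, ginv G b x i j * G x (b j) (b k) = ∑ j, ginv G b x i j * G x (b k) (b j) :=
          Finset.sum_congr rfl fun j _ => by rw [hs (b j) (b k)]
      _ = if k = i then 1 else 0 := h.symm
      _ = if i = k then 1 else 0 := by
          rcases eq_or_ne k i with h' | h'
          · simp [h']
          · simp [h', h'.symm]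
  have hinv : A⁻¹ = B := Matrix.inv_eq_left_inv hBA
  rw [hinv, hB, Matrix.of_apply]

end GramInverse

/-! ### The Laplace–Beltrami operator in the scalar-coefficient form -/

section SecondOrderForm

variable {E : Type*} [NormedAddCommGroup E] [InnerProductSpace ℝ E] [FiniteDimensional ℝ E]
  {ι : Type*} [Fintype ι] [DecidableEq ι] {G : E → E →L[ℝ] E →L[ℝ] ℝ}
  (b : OrthonormalBasis ι ℝ E) {x : E}

omit [FiniteDimensional ℝ E] [DecidableEq ι] in
/-- Expansion of a functional along an orthonormal basis: `α(v) = Σₘ ⟪bₘ, v⟫ α(bₘ)`. [folklore] -/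
theorem clm_apply_eq_sum_inner (α : E →L[ℝ] ℝ) (v : E) : α v = ∑ m, ⟪b m, v⟫ * α (b m) := by
  conv_lhs => rw [← b.sum_repr' v]
  rw [map_sum]
  exact Finset.sum_congr rfl fun m _ => by rw [map_smul, smul_eq_mul]

omit [DecidableEq ι] in
/-- **The coordinate Laplace–Beltrami operator with scalar coefficients.** For `f` of class `C²`
at `x`, `G x` invertible and an orthonormal basis `b`:
`Δ_G f(x) = Σₖₗ g^{lk} ∂ₗ∂ₖf(x) + Σₘ βₘ ∂ₘf(x)` with
`βₘ = -½ Σₖₗⱼ g^{kl} g^{mj} K(bₖ, bₗ, bⱼ)` (`K` the Koszul form, `Γ(bₖ,bₗ) = ½ ♯K(bₖ,bₗ,·)`),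
`g^{ij} = ginv G b x i j`, `∂ₗ∂ₖf = D(D f(·)(bₖ))(bₗ)`. [cite: ONeill1983, Ch. 3, Def. 3.50 ff.] -/
theorem lapAt_eq_secondOrderOp {f : E → ℝ} (hf : ContDiffAt ℝ 2 f x) :
    lapAt G f x =
      ∑ k, ∑ l, ginv G b.toBasis x l k * fderiv ℝ (fun z => fderiv ℝ f z (b k)) x (b l)
        + ∑ m, (-(2⁻¹ * ∑ k, ∑ l, ∑ j, ginv G b.toBasis x k l * ginv G b.toBasis x m j
            * koszulCLM G x (b k) (b l) (b j))) * fderiv ℝ f x (b m) := by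
  rw [lapAt_eq_sum G b.toBasis f x]
  simp only [OrthonormalBasis.coe_toBasis]
  -- second-order part: `D²f(bₖ)(bₗ) = ∂ₖ∂ₗ f`, then exchange the summation indices
  have h2 : ∀ k l, fderiv ℝ (fderiv ℝ f) x (b k) (b l) = fderiv ℝ (fun z => fderiv ℝ f z (b l)) x (b k) := by
    intro k l
    have hd : DifferentiableAt ℝ (fderiv ℝ f) x :=
      (hf.fderiv_right (m := 1) le_rfl).differentiableAt one_ne_zero
    rw [fderiv_clm_apply hd (differentiableAt_const _)]
    simp
  -- first-order part: `Df(Γ(bₖ,bₗ)) = Σₘ ⟪bₘ, Γ⟫ ∂ₘ f` and `⟪bₘ, Γ⟫ = ½ Σⱼ g^{mj} K(bₖ,bₗ,bⱼ)`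
  have h1 : ∀ k l, fderiv ℝ f x (chrAt G x (b k) (b l)) =
      ∑ m, (2⁻¹ * ∑ j, ginv G b.toBasis x m j * koszulCLM G x (b k) (b l) (b j))
        * fderiv ℝ f x (b m) := by
    intro k l
    rw [clm_apply_eq_sum_inner b (fderiv ℝ f x) (chrAt G x (b k) (b l))]
    refine Finset.sum_congr rfl fun m _ => ?_
    congr 1
    rw [← coord_toBasis_apply b m, chrAt_apply, map_smul, smul_eq_mul,
      coord_sharpAt_eq_sum b.toBasis]
    simp only [OrthonormalBasis.coe_toBasis]
  simp_rw [h2, h1, mul_sub]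
  rw [Finset.sum_congr rfl fun k _ => Finset.sum_sub_distrib .., Finset.sum_sub_distrib]
  -- collect the coefficient of `∂ₘ f` in the first-order part
  have step1 : ∀ k l, ginv G b.toBasis x k l *
      ∑ m, (2⁻¹ * ∑ j, ginv G b.toBasis x m j * koszulCLM G x (b k) (b l) (b j)) * fderiv ℝ f x (b m)
      = ∑ m, (2⁻¹ * ∑ j, ginv G b.toBasis x k l * ginv G b.toBasis x m j
          * koszulCLM G x (b k) (b l) (b j)) * fderiv ℝ f x (b m) := by
    intro k l
    rw [Finset.mul_sum]
    refine Finset.sum_congr rfl fun m _ => ?_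
    rw [Finset.mul_sum, Finset.mul_sum, ← mul_assoc]
    congr 1
    rw [Finset.mul_sum]
    exact Finset.sum_congr rfl fun j _ => by ring
  have key : ∑ k, ∑ l, ginv G b.toBasis x k l *
      ∑ m, (2⁻¹ * ∑ j, ginv G b.toBasis x m j * koszulCLM G x (b k) (b l) (b j)) * fderiv ℝ f x (b m)
      = ∑ m, (2⁻¹ * ∑ k, ∑ l, ∑ j, ginv G b.toBasis x k l * ginv G b.toBasis x m j
          * koszulCLM G x (b k) (b l) (b j)) * fderiv ℝ f x (b m) := by
    simp_rw [step1]
    rw [Finset.sum_congr rfl fun k _ => Finset.sum_comm, Finset.sum_comm]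
    refine Finset.sum_congr rfl fun m _ => ?_
    rw [Finset.sum_congr rfl fun k _ => (Finset.sum_mul ..).symm, ← Finset.sum_mul]
    congr 1
    rw [Finset.mul_sum]
    exact Finset.sum_congr rfl fun k _ => by rw [Finset.mul_sum]
  rw [key]
  simp only [neg_mul, Finset.sum_neg_distrib, sub_eq_add_neg]
  congr 1
  exact Finset.sum_comm

end SecondOrderForm

end MetricCoord

/-! ### From smooth symbols to pointwise bounds on the function and its partial derivatives -/

section SymbolBounds

variable {E : Type*} [NormedAddCommGroup E] [InnerProductSpace ℝ E]
  {k : ℕ} {a : ℝ} {f : E → ℝ}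

/-- **Pointwise form of a symbol estimate**: `‖∂^m f(y)‖ ≤ C ‖y‖^{a-m}` for `‖y‖ ≥ r₀`, with
`C ≥ 0`. [folklore] -/
theorem exists_norm_iteratedFDeriv_le_of_isBigOSmooth (hf : IsBigOSmooth k a f) {m : ℕ} (hm : m ≤ k) :
    ∃ C r₀ : ℝ, 0 ≤ C ∧ ∀ y : E, r₀ ≤ ‖y‖ → ‖iteratedFDeriv ℝ m f y‖ ≤ C * ‖y‖ ^ (a - m) := by
  obtain ⟨C, hC, hbound⟩ := (hf.isBigO hm).exists_pos
  obtain ⟨R, hR⟩ := exists_radius_of_eventually_cobounded hbound.bound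
  refine ⟨C, R + 1, hC.le, fun y hy => ?_⟩
  have h := hR y (by linarith)
  rwa [norm_norm, Real.norm_of_nonneg (Real.rpow_nonneg (norm_nonneg _) _)] at h

/-- **Pointwise bounds for a symbol and its first two partial derivatives along unit vectors.**
If `f ∈ O_2(r^a)` then for `‖y‖ ≥ r₀` (`f` being `C²` there): `|f(y)| ≤ C‖y‖^a`,
`|∂ᵥf(y)| ≤ C‖y‖^{a-1}` and `|∂_w∂ᵥf(y)| ≤ C‖y‖^{a-2}` for all `‖v‖, ‖w‖ ≤ 1`. [folklore] -/
theorem exists_partial_bounds_of_isBigOSmooth (hf : IsBigOSmooth 2 a f) :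
    ∃ C r₀ : ℝ, 0 ≤ C ∧ ∀ y : E, r₀ ≤ ‖y‖ →
      ContDiffAt ℝ ∞ f y ∧ |f y| ≤ C * ‖y‖ ^ a ∧
      (∀ v : E, ‖v‖ ≤ 1 → |fderiv ℝ f y v| ≤ C * ‖y‖ ^ (a - 1)) ∧
      (∀ v w : E, ‖v‖ ≤ 1 → ‖w‖ ≤ 1 →
        |fderiv ℝ (fun z => fderiv ℝ f z v) y w| ≤ C * ‖y‖ ^ (a - 2)) := by
  obtain ⟨C₀, r₀, hC₀, h₀⟩ := exists_norm_iteratedFDeriv_le_of_isBigOSmooth hf (m := 0) (by norm_num)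
  obtain ⟨C₁, r₁, hC₁, h₁⟩ := exists_norm_iteratedFDeriv_le_of_isBigOSmooth hf (m := 1) (by norm_num)
  obtain ⟨C₂, r₂, hC₂, h₂⟩ := exists_norm_iteratedFDeriv_le_of_isBigOSmooth hf (m := 2) le_rfl
  obtain ⟨R₀, hR₀⟩ := hf.eventually_contDiffAt
  refine ⟨max C₀ (max C₁ C₂), max (max r₀ r₁) (max r₂ (R₀ + 1)), by positivity, fun y hy => ?_⟩
  have hy0 : r₀ ≤ ‖y‖ := le_trans (le_max_left _ _) ((le_max_left _ _).trans hy)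
  have hy1 : r₁ ≤ ‖y‖ := le_trans (le_max_right _ _) ((le_max_left _ _).trans hy)
  have hy2 : r₂ ≤ ‖y‖ := le_trans (le_max_left _ _) ((le_max_right _ _).trans hy)
  have hyR : R₀ < ‖y‖ := by
    have := le_trans (le_max_right _ _) ((le_max_right _ _).trans hy)
    linarith
  have hfy : ContDiffAt ℝ ∞ f y := hR₀ y hyR
  have hfy2 : ContDiffAt ℝ 2 f y := hfy.of_le (WithTop.coe_le_coe.mpr le_top)
  have hpow : ∀ s : ℝ, 0 ≤ ‖y‖ ^ s := fun s => Real.rpow_nonneg (norm_nonneg _) _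
  refine ⟨hfy, ?_, fun v hv => ?_, fun v w hv hw => ?_⟩
  · have h := h₀ y hy0
    rw [norm_iteratedFDeriv_zero, Real.norm_eq_abs, Nat.cast_zero, sub_zero] at h
    exact h.trans (mul_le_mul_of_nonneg_right (le_max_left _ _) (hpow _))
  · have h := h₁ y hy1
    have happ : |fderiv ℝ f y v| ≤ ‖iteratedFDeriv ℝ 1 f y‖ * ‖v‖ := by
      have := (iteratedFDeriv ℝ 1 f y).le_opNorm ![v]
      rw [iteratedFDeriv_one_apply] at this
      simpa [Real.norm_eq_abs] using this
    calc |fderiv ℝ f y v| ≤ ‖iteratedFDeriv ℝ 1 f y‖ * ‖v‖ := happ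
      _ ≤ C₁ * ‖y‖ ^ (a - 1) * 1 := by
          rw [Nat.cast_one] at h
          exact mul_le_mul h hv (norm_nonneg _) (mul_nonneg hC₁ (hpow _))
      _ ≤ max C₀ (max C₁ C₂) * ‖y‖ ^ (a - 1) := by
          rw [mul_one]
          exact mul_le_mul_of_nonneg_right ((le_max_left _ _).trans (le_max_right _ _)) (hpow _)
  · have h := h₂ y hy2
    have heq : fderiv ℝ (fun z => fderiv ℝ f z v) y w = iteratedFDeriv ℝ 2 f y ![w, v] := by
      have hd : DifferentiableAt ℝ (fderiv ℝ f) y :=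
        (hfy2.fderiv_right (m := 1) le_rfl).differentiableAt one_ne_zero
      rw [iteratedFDeriv_two_apply, fderiv_clm_apply hd (differentiableAt_const v)]
      simp
    have happ : |fderiv ℝ (fun z => fderiv ℝ f z v) y w| ≤ ‖iteratedFDeriv ℝ 2 f y‖ * (‖w‖ * ‖v‖) := by
      have := (iteratedFDeriv ℝ 2 f y).le_opNorm ![w, v]
      rw [← heq] at this
      simpa [Real.norm_eq_abs, Fin.prod_univ_two] using this
    calc |fderiv ℝ (fun z => fderiv ℝ f z v) y w| ≤ ‖iteratedFDeriv ℝ 2 f y‖ * (‖w‖ * ‖v‖) := happ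
      _ ≤ C₂ * ‖y‖ ^ (a - 2) * 1 := by
          rw [Nat.cast_two] at h
          refine mul_le_mul h ?_ (by positivity) (mul_nonneg hC₂ (hpow _))
          calc ‖w‖ * ‖v‖ ≤ 1 * 1 := mul_le_mul hw hv (norm_nonneg _) zero_le_one
            _ = 1 := one_mul _
      _ ≤ max C₀ (max C₁ C₂) * ‖y‖ ^ (a - 2) := by
          rw [mul_one]
          exact mul_le_mul_of_nonneg_right ((le_max_right _ _).trans (le_max_right _ _)) (hpow _)

/-- **Uniform pointwise bounds for a finite family of symbols**: one constant and one radius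
serve for all members of a finite family `fᵢ ∈ O_2(r^{aᵢ})`. [folklore] -/
theorem exists_uniform_partial_bounds_of_isBigOSmooth {ι' : Type*} [Finite ι'] {a' : ι' → ℝ}
    {f' : ι' → E → ℝ} (hf : ∀ i, IsBigOSmooth 2 (a' i) (f' i)) :
    ∃ C r₀ : ℝ, 0 ≤ C ∧ ∀ i (y : E), r₀ ≤ ‖y‖ →
      ContDiffAt ℝ ∞ (f' i) y ∧ |f' i y| ≤ C * ‖y‖ ^ (a' i) ∧
      (∀ v : E, ‖v‖ ≤ 1 → |fderiv ℝ (f' i) y v| ≤ C * ‖y‖ ^ (a' i - 1)) ∧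
      (∀ v w : E, ‖v‖ ≤ 1 → ‖w‖ ≤ 1 →
        |fderiv ℝ (fun z => fderiv ℝ (f' i) z v) y w| ≤ C * ‖y‖ ^ (a' i - 2)) := by
  choose C r hC h using fun i => exists_partial_bounds_of_isBigOSmooth (hf i)
  obtain ⟨C₀, hC₀⟩ := (Set.finite_range C).bddAbove
  obtain ⟨R, hR⟩ := (Set.finite_range r).bddAbove
  refine ⟨max C₀ 0, R, le_max_right _ _, fun i y hy => ?_⟩
  have hCi : C i ≤ max C₀ 0 := (hC₀ (Set.mem_range_self i)).trans (le_max_left _ _)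
  have hri : r i ≤ R := hR (Set.mem_range_self i)
  obtain ⟨h1, h2, h3, h4⟩ := h i y (hri.trans hy)
  have hp : ∀ s : ℝ, 0 ≤ ‖y‖ ^ s := fun s => Real.rpow_nonneg (norm_nonneg _) _
  exact ⟨h1, h2.trans (mul_le_mul_of_nonneg_right hCi (hp _)),
    fun v hv => (h3 v hv).trans (mul_le_mul_of_nonneg_right hCi (hp _)),
    fun v w hv hw => (h4 v w hv hw).trans (mul_le_mul_of_nonneg_right hCi (hp _))⟩

end SymbolBounds

/-! ### More symbol calculus: linear maps, `1/r` to all orders -/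

section MoreSymbols

variable {E : Type*} [NormedAddCommGroup E] [NormedSpace ℝ E]
  {W : Type*} [NormedAddCommGroup W] [NormedSpace ℝ W] {k : ℕ} {a : ℝ}

/-- **Order from the derivative**: if `f ∈ O_0(r^a)` and `Df ∈ O_k(r^{a-1})` then
`f ∈ O_{k+1}(r^a)` (`‖∂^{m+1} f‖ = ‖∂^m Df‖`). [folklore] -/
theorem IsBigOSmooth.of_fderiv {f : E → W} (h0 : IsBigOSmooth 0 a f)
    (h1 : IsBigOSmooth k (a - 1) (_root_.fderiv ℝ f)) : IsBigOSmooth (k + 1) a f := by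
  refine ⟨h0.1, fun m hm ↦ ?_⟩
  rcases Nat.eq_zero_or_pos m with rfl | hm0
  · exact h0.isBigO le_rfl
  · obtain ⟨n, rfl⟩ : ∃ n, m = n + 1 := ⟨m - 1, by omega⟩
    have h := h1.isBigO (m := n) (by omega)
    have hfun : (fun x ↦ ‖iteratedFDeriv ℝ (n + 1) f x‖) =
        fun x ↦ ‖iteratedFDeriv ℝ n (_root_.fderiv ℝ f) x‖ :=
      funext fun x ↦ norm_iteratedFDeriv_fderiv.symm
    rw [hfun]
    refine h.congr_right fun x ↦ ?_
    push_cast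
    ring_nf

/-- **Continuous linear maps are symbols of order `1`** (`‖Ly‖ ≤ ‖L‖ r`, `DL = L` constant,
higher derivatives vanish). [folklore] -/
theorem isBigOSmooth_clm_apply (L : E →L[ℝ] W) : ∀ k : ℕ, IsBigOSmooth k 1 fun y ↦ L y
  | 0 => by
      refine ⟨⟨0, L.contDiff.contDiffOn⟩, fun m hm ↦ ?_⟩
      obtain rfl : m = 0 := Nat.le_zero.1 hm
      simp only [norm_iteratedFDeriv_zero, Nat.cast_zero, sub_zero, Real.rpow_one]
      refine IsBigO.of_bound ‖L‖ (Eventually.of_forall fun x ↦ ?_)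
      rw [Real.norm_of_nonneg (norm_nonneg _), Real.norm_of_nonneg (norm_nonneg _)]
      exact L.le_opNorm x
  | k + 1 => by
      refine (isBigOSmooth_clm_apply L 0).of_fderiv ?_
      have h : IsBigOSmooth k 0 fun _ : E ↦ L := isBigOSmooth_const k L
      rw [show (1 : ℝ) - 1 = 0 by norm_num]
      exact h.congr fun y ↦ (L.fderiv (x := y)).symm

variable {E' : Type*} [NormedAddCommGroup E'] [InnerProductSpace ℝ E']

/-- **`1/r` is a symbol of order `−1` to every order**: `D(1/r) = −r⁻³ ⟨y, ·⟩` is a product of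
the symbols `r⁻³` and `y ↦ ⟨y, ·⟩`, and induction on the order. [folklore] -/
theorem isBigOSmooth_inv_norm_all : ∀ k : ℕ, IsBigOSmooth k (-1) fun y : E' ↦ ‖y‖⁻¹
  | 0 => isBigOSmooth_inv_norm.of_le (Nat.zero_le _)
  | k + 1 => by
      have hk := isBigOSmooth_inv_norm_all k
      have h3 : IsBigOSmooth k (-3) fun y : E' ↦ -(‖y‖⁻¹ * ‖y‖⁻¹ * ‖y‖⁻¹) := by
        have h := ((hk.mul hk).mul hk).neg
        rwa [show (-1 : ℝ) + -1 + -1 = -3 by norm_num] at h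
      have hD : IsBigOSmooth k (-1 - 1) (_root_.fderiv ℝ fun y : E' ↦ ‖y‖⁻¹) := by
        have h := h3.smul (isBigOSmooth_clm_apply (innerSL ℝ : E' →L[ℝ] E' →L[ℝ] ℝ) k)
        rw [show (-3 : ℝ) + 1 = -1 - 1 by norm_num] at h
        refine h.congr_far (R₁ := 0) fun y hy ↦ ?_
        have hy0 : y ≠ 0 := norm_pos_iff.1 hy
        rw [(hasFDerivAt_inv_norm hy0).fderiv]
        congr 1
        have : ‖y‖ ≠ 0 := norm_ne_zero_iff.2 hy0
        field_simp
      exact (isBigOSmooth_inv_norm.of_le (Nat.zero_le _)).of_fderiv hD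

end MoreSymbols

/-! ### Norms of the first two derivatives through partial derivatives -/

section PartialNorms

variable {E : Type*} [NormedAddCommGroup E] [InnerProductSpace ℝ E]
  {F : Type*} [NormedAddCommGroup F] [NormedSpace ℝ F]
  {ι : Type*} [Fintype ι] (b : OrthonormalBasis ι ℝ E)

/-- `‖L‖ ≤ Σᵢ ‖L bᵢ‖` for an orthonormal basis `b`. [folklore] -/
theorem opNorm_le_sum_norm_apply_orthonormalBasis (L : E →L[ℝ] F) : ‖L‖ ≤ ∑ i, ‖L (b i)‖ := by
  refine ContinuousLinearMap.opNorm_le_bound _ (Finset.sum_nonneg fun _ _ ↦ norm_nonneg _)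
    fun x ↦ ?_
  have hx : L x = ∑ i, ⟪b i, x⟫ • L (b i) := by
    conv_lhs => rw [← b.sum_repr' x]
    simp [map_sum, map_smul]
  rw [hx, Finset.sum_mul]
  refine (norm_sum_le _ _).trans (Finset.sum_le_sum fun i _ ↦ ?_)
  rw [norm_smul, mul_comm]
  refine mul_le_mul_of_nonneg_left ?_ (norm_nonneg _)
  have h := norm_inner_le_norm (𝕜 := ℝ) (b i) x
  rwa [b.orthonormal.1 i, one_mul] at h

/-- `‖Df(x)‖ ≤ Σᵢ |∂ᵢ f(x)|`. [folklore] -/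
theorem norm_iteratedFDeriv_one_le_sum (f : E → ℝ) (x : E) :
    ‖iteratedFDeriv ℝ 1 f x‖ ≤ ∑ i, |fderiv ℝ f x (b i)| := by
  rw [norm_iteratedFDeriv_one]
  exact (opNorm_le_sum_norm_apply_orthonormalBasis b _).trans
    (le_of_eq (Finset.sum_congr rfl fun i _ ↦ Real.norm_eq_abs _))

/-- `‖D²f(x)‖ ≤ Σᵢⱼ |∂ᵢ∂ⱼ f(x)|` for `f` of class `C²` at `x`. [folklore] -/
theorem norm_iteratedFDeriv_two_le_sum {f : E → ℝ} {x : E} (hf : ContDiffAt ℝ 2 f x) :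
    ‖iteratedFDeriv ℝ 2 f x‖ ≤ ∑ i, ∑ j, |fderiv ℝ (fun z ↦ fderiv ℝ f z (b j)) x (b i)| := by
  rw [← norm_iteratedFDeriv_fderiv, norm_iteratedFDeriv_one]
  refine (opNorm_le_sum_norm_apply_orthonormalBasis b _).trans (Finset.sum_le_sum fun i _ ↦ ?_)
  refine (opNorm_le_sum_norm_apply_orthonormalBasis b _).trans
    (le_of_eq (Finset.sum_congr rfl fun j _ ↦ ?_))
  rw [Real.norm_eq_abs]
  congr 1
  have hd : DifferentiableAt ℝ (fderiv ℝ f) x :=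
    (hf.fderiv_right (m := 1) le_rfl).differentiableAt one_ne_zero
  rw [fderiv_clm_apply hd (differentiableAt_const _)]
  simp

end PartialNorms

/-! ### Square integrals over balls in `ℝ³` from pointwise bounds -/

section BallIntegrals

open _root_.MeasureTheory Metric

/-- `∫_{B̄(x,s)} f² ≤ 6 M² s³` if `|f| ≤ M` on `B̄(x, s) ⊆ ℝ³` (`vol B̄(x,s) = 4πs³/3 ≤ 6s³`; if
`f²` is not integrable the integral is `0`). [folklore] -/
theorem setIntegral_closedBall_sq_le {f : E3 → ℝ} {x : E3} {s M : ℝ} (hs : 0 ≤ s)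
    (hf : ∀ y ∈ closedBall x s, |f y| ≤ M) :
    ∫ y in closedBall x s, f y ^ 2 ≤ 6 * M ^ 2 * s ^ 3 := by
  have hM : 0 ≤ M := (abs_nonneg _).trans (hf x (mem_closedBall_self hs))
  by_cases hi : IntegrableOn (fun y ↦ f y ^ 2) (closedBall x s)
  · have hvol : (volume (closedBall x s)).toReal = s ^ 3 * (Real.pi * 4 / 3) := by
      rw [EuclideanSpace.volume_closedBall_fin_three, ENNReal.toReal_mul, ENNReal.toReal_pow,
        ENNReal.toReal_ofReal hs, ENNReal.toReal_ofReal (by positivity)]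
    have hfin : volume (closedBall x s) < ⊤ := measure_closedBall_lt_top
    calc ∫ y in closedBall x s, f y ^ 2 ≤ ∫ y in closedBall x s, M ^ 2 := by
          refine setIntegral_mono_on hi (integrableOn_const hfin.ne) measurableSet_closedBall
            fun y hy ↦ ?_
          have h := hf y hy
          rw [← sq_abs]
          exact pow_le_pow_left₀ (abs_nonneg _) h 2
      _ = M ^ 2 * (s ^ 3 * (Real.pi * 4 / 3)) := by
          rw [setIntegral_const, measureReal_def, hvol, smul_eq_mul, mul_comm]
      _ ≤ 6 * M ^ 2 * s ^ 3 := by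
          have hπ : Real.pi * 4 / 3 ≤ 6 := by linarith [Real.pi_le_four]
          have h0 : 0 ≤ M ^ 2 * s ^ 3 := by positivity
          nlinarith
  · rw [integral_undef hi]
    positivity

end BallIntegrals

/-! ### The coefficients on an asymptotically flat end as smooth symbols -/

namespace AFEnd

variable {X : Type} [TopologicalSpace X] [ChartedSpace E3 X] [IsManifold (𝓡 3) ∞ X]
  (e : AFEnd X) (D : InitialDataSet (𝓡 3) X) {k : ℕ} {β : ℝ}
  {ι : Type*} [Fintype ι] [DecidableEq ι] (b : OrthonormalBasis ι ℝ E3)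

/-- **`g^{ij} − δ^{ij} ∈ O_k(r^{−β})`**: the inverse Gram matrix of an end with
`h − δ ∈ O_k(r^{−β})`, `β > 0`, differs from the identity by a symbol of order `−β`
(`A⁻¹ − 1 = A⁻¹ (1 − A)` far out, where `A → 1` is invertible). Schoen–Yau 1979, p. 47
(`g^{ij} = δ^{ij} + O(r⁻¹)`). [cite: SchoenYauPMT1979, §1 p. 47] -/
theorem isBigOSmooth_gram_inv_sub_one
    (hH : IsBigOSmooth k (-β) fun y ↦ hCoeff e D y - (innerSL ℝ : E3 →L[ℝ] E3 →L[ℝ] ℝ))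
    (hβ : 0 < β) (i j : ι) :
    IsBigOSmooth k (-β) fun y ↦
      (Matrix.of fun i j ↦ hCoeff e D y (b i) (b j))⁻¹ i j - if i = j then 1 else 0 := by
  set A : E3 → Matrix ι ι ℝ := fun y ↦ Matrix.of fun i j ↦ hCoeff e D y (b i) (b j) with hA
  -- entries of `A − 1` are `O_k(r^{−β})`, entries of `A⁻¹` are `O_k(1)`
  have hδ : ∀ l j : ι, (innerSL ℝ : E3 →L[ℝ] E3 →L[ℝ] ℝ) (b l) (b j) = if l = j then 1 else 0 :=
    fun l j ↦ by rw [innerSL_apply_apply]; exact orthonormal_iff_ite.1 b.orthonormal l j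
  have hsub : ∀ l j, IsBigOSmooth k (-β) fun y ↦ (if l = j then (1 : ℝ) else 0) - A y l j := by
    intro l j
    have h := ((hH.clm_apply_const (b l)).clm_apply_const (b j)).neg
    refine h.congr fun y ↦ ?_
    simp only [hA, Matrix.of_apply, _root_.sub_apply, hδ, neg_sub]
  have hinv : ∀ i l, IsBigOSmooth k 0 fun y ↦ (A y)⁻¹ i l := fun i l ↦
    e.isBigOSmooth_gram_inv D b hH hβ i l
  have hsum := IsBigOSmooth.finset_sum (Finset.univ : Finset ι) fun l _ ↦
    (hinv i l).mul (hsub l j)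
  simp only [zero_add] at hsum
  -- far out `A` is invertible, and there `A⁻¹ − 1 = A⁻¹ (1 − A)`
  have hentry : ∀ i j, Tendsto (fun y ↦ hCoeff e D y (b i) (b j)) (cobounded E3)
      (𝓝 ((1 : Matrix ι ι ℝ) i j)) := by
    intro i j
    have h := (e.tendsto_hCoeff_sub_apply D hH hβ (b i) (b j)).add_const (inner ℝ (b i) (b j))
    simp only [zero_add, sub_add_cancel] at h
    rwa [Matrix.one_apply, ← orthonormal_iff_ite.1 b.orthonormal i j]
  have hmat : Tendsto A (cobounded E3) (𝓝 (1 : Matrix ι ι ℝ)) :=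
    tendsto_pi_nhds.2 fun i ↦ tendsto_pi_nhds.2 fun j ↦ hentry i j
  have hdet := ((continuous_id.matrix_det).tendsto (1 : Matrix ι ι ℝ)).comp hmat
  rw [id_eq, Matrix.det_one] at hdet
  have hfar : ∀ᶠ y in cobounded E3, (A y).det ≠ 0 :=
    (hdet.eventually (isOpen_ne.mem_nhds one_ne_zero))
  obtain ⟨R₁, hR₁⟩ := exists_radius_of_eventually_cobounded hfar
  refine hsum.congr_far (R₁ := R₁) fun y hy ↦ ?_
  have hunit : IsUnit (A y).det := isUnit_iff_ne_zero.2 (hR₁ y hy)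
  have hmul : (A y)⁻¹ * A y = 1 := Matrix.nonsing_inv_mul _ hunit
  have hij : ∑ l, (A y)⁻¹ i l * A y l j = if i = j then 1 else 0 := by
    have := congr_fun (congr_fun hmul i) j
    rwa [Matrix.mul_apply, Matrix.one_apply] at this
  have hone : ∑ l, (A y)⁻¹ i l * (if l = j then (1 : ℝ) else 0) = (A y)⁻¹ i j := by
    simp [Finset.sum_ite_eq', mul_comm]
  calc ∑ l, (A y)⁻¹ i l * ((if l = j then (1 : ℝ) else 0) - A y l j)
      = ∑ l, (A y)⁻¹ i l * (if l = j then (1 : ℝ) else 0) - ∑ l, (A y)⁻¹ i l * A y l j := by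
        rw [← Finset.sum_sub_distrib]; exact Finset.sum_congr rfl fun l _ ↦ by ring
    _ = (A y)⁻¹ i j - if i = j then 1 else 0 := by rw [hone, hij]

/-- **`ginv − δ ∈ O_k(r^{−β})` for the inverse metric coefficients of the end** (in an
orthonormal frame, `ginv = ((h(bᵢ,bⱼ))ᵢⱼ)⁻¹` on the exterior region, `ginv_eq_inv`).
[cite: SchoenYauPMT1979, §1 p. 47] -/
theorem isBigOSmooth_ginv_sub
    (hH : IsBigOSmooth k (-β) fun y ↦ hCoeff e D y - (innerSL ℝ : E3 →L[ℝ] E3 →L[ℝ] ℝ))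
    (hβ : 0 < β) (i j : ι) :
    IsBigOSmooth k (-β) fun y ↦
      MetricCoord.ginv (hCoeff e D) b.toBasis y i j - if i = j then 1 else 0 := by
  refine (e.isBigOSmooth_gram_inv_sub_one D b hH hβ i j).congr_far (R₁ := e.R) fun y hy ↦ ?_
  rw [MetricCoord.ginv_eq_inv b.toBasis ((e.isMetricOn_hCoeff D).isInvertible y hy)
    (hCoeff_symm e D y) i j]
  simp only [OrthonormalBasis.coe_toBasis]

/-- The inverse metric coefficients of the end are symbols of order `0`. [folklore] -/
theorem isBigOSmooth_ginv
    (hH : IsBigOSmooth k (-β) fun y ↦ hCoeff e D y - (innerSL ℝ : E3 →L[ℝ] E3 →L[ℝ] ℝ))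
    (hβ : 0 < β) (i j : ι) :
    IsBigOSmooth k 0 fun y ↦ MetricCoord.ginv (hCoeff e D) b.toBasis y i j := by
  have h := (isBigOSmooth_const k (if i = j then (1 : ℝ) else 0)).add
    ((e.isBigOSmooth_ginv_sub D b hH hβ i j).mono (by linarith : -β ≤ 0))
  exact h.congr fun y ↦ by ring

/-- **The first-order coefficients of `Δ_h` in the chart are `O_k(r^{−β−1})`**:
`βₘ = -½ Σₖₗⱼ g^{kl} g^{mj} K(bₖ, bₗ, bⱼ)` with the Koszul form `K = ∂h + ∂h − ∂h ∈ O(r^{−β−1})`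
(Schoen–Yau 1979, (1.1): `|∂h| ≤ k₂ r⁻³`). [cite: SchoenYauPMT1979, §1 (1.1)] -/
theorem isBigOSmooth_firstOrderCoeff
    (hH : IsBigOSmooth (k + 1) (-β) fun y ↦ hCoeff e D y - (innerSL ℝ : E3 →L[ℝ] E3 →L[ℝ] ℝ))
    (hβ : 0 < β) (m : ι) :
    IsBigOSmooth k (-β - 1) fun y ↦
      -(2⁻¹ * ∑ k, ∑ l, ∑ j, MetricCoord.ginv (hCoeff e D) b.toBasis y k l
        * MetricCoord.ginv (hCoeff e D) b.toBasis y m j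
        * MetricCoord.koszulCLM (hCoeff e D) y (b k) (b l) (b j)) := by
  have hH' : IsBigOSmooth k (-β) fun y ↦ hCoeff e D y - (innerSL ℝ : E3 →L[ℝ] E3 →L[ℝ] ℝ) :=
    hH.of_le (Nat.le_succ k)
  have hK : ∀ k₀ l j : ι, IsBigOSmooth k (-β - 1) fun y ↦
      MetricCoord.koszulCLM (hCoeff e D) y (b k₀) (b l) (b j) := by
    intro k₀ l j
    have h := ((e.isBigOSmooth_fderiv_hCoeff_apply D hH (b k₀) (b l) (b j)).add
      (e.isBigOSmooth_fderiv_hCoeff_apply D hH (b l) (b j) (b k₀))).sub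
      (e.isBigOSmooth_fderiv_hCoeff_apply D hH (b j) (b k₀) (b l))
    exact h.congr fun y ↦ (MetricCoord.koszulCLM_apply (hCoeff e D) y (b k₀) (b l) (b j)).symm
  have hprod : ∀ k₀ l j : ι, IsBigOSmooth k (-β - 1) fun y ↦
      MetricCoord.ginv (hCoeff e D) b.toBasis y k₀ l * MetricCoord.ginv (hCoeff e D) b.toBasis y m j
        * MetricCoord.koszulCLM (hCoeff e D) y (b k₀) (b l) (b j) := by
    intro k₀ l j
    have h := ((e.isBigOSmooth_ginv D b hH' hβ k₀ l).mul (e.isBigOSmooth_ginv D b hH' hβ m j)).mul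
      (hK k₀ l j)
    simp only [add_zero, zero_add] at h
    exact h
  have hsum := IsBigOSmooth.finset_sum (Finset.univ : Finset ι) fun k₀ _ ↦
    IsBigOSmooth.finset_sum (Finset.univ : Finset ι) fun l _ ↦
      IsBigOSmooth.finset_sum (Finset.univ : Finset ι) fun j _ ↦ hprod k₀ l j
  exact (hsum.const_mul 2⁻¹).neg

/-- **The scalar curvature of the end read in the chart is `O_k(r^{−β−2})`**
(`R∘Φ = Σ g^{lk} Ric_{kl}` with `Ric_{kl} ∈ O(r^{−β−2})`, `isBigOSmooth_ricciSum`).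
Schoen–Yau 1979, (1.2) region: `|R| = O(r⁻⁴)` under (1.1) with `M = 0`.
[cite: SchoenYauPMT1979, §1 (1.1)–(1.2)] -/
theorem isBigOSmooth_scalarCurvatureCoeff [D.metric.HasLeviCivita]
    (hH : IsBigOSmooth (k + 2) (-β) fun y ↦ hCoeff e D y - (innerSL ℝ : E3 →L[ℝ] E3 →L[ℝ] ℝ))
    (hβ : 0 < β) : IsBigOSmooth k (-β - 2) (scalarCurvatureCoeff e D) := by
  set b₀ := EuclideanSpace.basisFun (Fin 3) ℝ with hb₀
  have hH' : IsBigOSmooth k (-β) fun y ↦ hCoeff e D y - (innerSL ℝ : E3 →L[ℝ] E3 →L[ℝ] ℝ) :=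
    hH.of_le (by omega)
  have h := IsBigOSmooth.finset_sum (Finset.univ : Finset (Fin 3)) fun k₀ _ ↦
    IsBigOSmooth.finset_sum (Finset.univ : Finset (Fin 3)) fun l _ ↦
      ((e.isBigOSmooth_gram_inv D b₀ hH' hβ l k₀).mul (e.isBigOSmooth_ricciSum D b₀ hH hβ k₀ l))
  simp only [zero_add] at h
  exact h.congr_far (R₁ := e.R) fun y hy ↦ (e.scalarCurvatureCoeff_eq_coord D b₀ hy).symm

/-- **The coefficient bounds of the chart equation on an `O_4(r⁻²)` end** (the input of the decay
bootstrap). With `a_{kl} = g^{lk}`, `βₘ` the first-order coefficients of `Δ_h` and `R∘Φ` the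
scalar curvature in the chart, for `|y| ≥ r₁ ≥ 1` and one constant `K`:
`Σ|a − δ| ≤ K r⁻²`, `|∂a| ≤ K r⁻³`, `|∂²a| ≤ K r⁻⁴`; `Σ|β| ≤ K r⁻³`, `|∂β| ≤ K r⁻⁴`, `|∂²β| ≤ K r⁻⁵`;
`|R| ≤ K r⁻⁴`, `|∂R| ≤ K r⁻⁵`, `|∂²R| ≤ K r⁻⁶`, all coefficients being smooth there. This is
Schoen–Yau's (1.1) with `h = δ + O''(r⁻²)` (p. 47 and §3, proof of Lemma 3.3).
[cite: SchoenYauPMT1979, §1 (1.1), §3 Lemma 3.3] -/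
theorem exists_chartCoeff_bounds [D.metric.HasLeviCivita] (b : OrthonormalBasis (Fin 3) ℝ E3)
    (hH : IsBigOSmooth 4 (-2) fun y ↦ hCoeff e D y - (innerSL ℝ : E3 →L[ℝ] E3 →L[ℝ] ℝ)) :
    ∃ K r₁ : ℝ, 0 ≤ K ∧ 1 ≤ r₁ ∧ e.R < r₁ ∧ ∀ y : E3, r₁ ≤ ‖y‖ →
      ((∀ k l, ContDiffAt ℝ ∞ (fun z ↦ MetricCoord.ginv (hCoeff e D) b.toBasis z l k) y) ∧
        (∑ k, ∑ l, |MetricCoord.ginv (hCoeff e D) b.toBasis y l k - if k = l then 1 else 0|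
          ≤ K * ‖y‖ ^ (-2 : ℝ)) ∧
        (∀ i k l, |fderiv ℝ (fun z ↦ MetricCoord.ginv (hCoeff e D) b.toBasis z l k) y (b i)|
          ≤ K * ‖y‖ ^ (-3 : ℝ)) ∧
        (∀ i j k l, |fderiv ℝ (fun z ↦ fderiv ℝ
            (fun z' ↦ MetricCoord.ginv (hCoeff e D) b.toBasis z' l k) z (b i)) y (b j)|
          ≤ K * ‖y‖ ^ (-4 : ℝ))) ∧
      ((∀ m, ContDiffAt ℝ ∞ (fun z ↦ -(2⁻¹ * ∑ k, ∑ l, ∑ j,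
          MetricCoord.ginv (hCoeff e D) b.toBasis z k l * MetricCoord.ginv (hCoeff e D) b.toBasis z m j
            * MetricCoord.koszulCLM (hCoeff e D) z (b k) (b l) (b j))) y) ∧
        (∑ m, |-(2⁻¹ * ∑ k, ∑ l, ∑ j,
          MetricCoord.ginv (hCoeff e D) b.toBasis y k l * MetricCoord.ginv (hCoeff e D) b.toBasis y m j
            * MetricCoord.koszulCLM (hCoeff e D) y (b k) (b l) (b j))| ≤ K * ‖y‖ ^ (-3 : ℝ)) ∧
        (∀ i m, |fderiv ℝ (fun z ↦ -(2⁻¹ * ∑ k, ∑ l, ∑ j,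
          MetricCoord.ginv (hCoeff e D) b.toBasis z k l * MetricCoord.ginv (hCoeff e D) b.toBasis z m j
            * MetricCoord.koszulCLM (hCoeff e D) z (b k) (b l) (b j))) y (b i)| ≤ K * ‖y‖ ^ (-4 : ℝ)) ∧
        (∀ i i' m, |fderiv ℝ (fun z ↦ fderiv ℝ (fun z' ↦ -(2⁻¹ * ∑ k, ∑ l, ∑ j,
          MetricCoord.ginv (hCoeff e D) b.toBasis z' k l * MetricCoord.ginv (hCoeff e D) b.toBasis z' m j
            * MetricCoord.koszulCLM (hCoeff e D) z' (b k) (b l) (b j))) z (b i)) y (b i')|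
          ≤ K * ‖y‖ ^ (-5 : ℝ))) ∧
      (ContDiffAt ℝ ∞ (scalarCurvatureCoeff e D) y ∧
        |scalarCurvatureCoeff e D y| ≤ K * ‖y‖ ^ (-4 : ℝ) ∧
        (∀ i, |fderiv ℝ (scalarCurvatureCoeff e D) y (b i)| ≤ K * ‖y‖ ^ (-5 : ℝ)) ∧
        (∀ i j, |fderiv ℝ (fun z ↦ fderiv ℝ (scalarCurvatureCoeff e D) z (b i)) y (b j)|
          ≤ K * ‖y‖ ^ (-6 : ℝ))) := by
  have hb1 : ∀ i, ‖b i‖ ≤ 1 := fun i => (b.orthonormal.1 i).le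
  have two : (0 : ℝ) < 2 := two_pos
  -- the three families of symbols
  have hA : ∀ p : Fin 3 × Fin 3, IsBigOSmooth 2 (-2) fun y ↦
      MetricCoord.ginv (hCoeff e D) b.toBasis y p.2 p.1 - if p.1 = p.2 then 1 else 0 := by
    intro p
    have h := (e.isBigOSmooth_ginv_sub D b (k := 2) (hH.of_le (show 2 ≤ 4 by norm_num)) two p.2 p.1)
    refine h.congr fun y ↦ ?_
    rcases eq_or_ne p.1 p.2 with h' | h'
    · simp [h']
    · simp [h', h'.symm]
  have hB : ∀ m : Fin 3, IsBigOSmooth 2 (-2 - 1) fun y ↦ -(2⁻¹ * ∑ k, ∑ l, ∑ j,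
      MetricCoord.ginv (hCoeff e D) b.toBasis y k l * MetricCoord.ginv (hCoeff e D) b.toBasis y m j
        * MetricCoord.koszulCLM (hCoeff e D) y (b k) (b l) (b j)) := fun m =>
    (e.isBigOSmooth_firstOrderCoeff D b (k := 2) (hH.of_le (show 3 ≤ 4 by norm_num)) two m)
  have hC : ∀ _ : Unit, IsBigOSmooth 2 (-2 - 2) (scalarCurvatureCoeff e D) := fun _ =>
    e.isBigOSmooth_scalarCurvatureCoeff D (k := 2) hH two
  obtain ⟨C₁, s₁, hC₁, h₁⟩ := exists_uniform_partial_bounds_of_isBigOSmooth hA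
  obtain ⟨C₂, s₂, hC₂, h₂⟩ := exists_uniform_partial_bounds_of_isBigOSmooth hB
  obtain ⟨C₃, s₃, hC₃, h₃⟩ := exists_uniform_partial_bounds_of_isBigOSmooth hC
  refine ⟨9 * C₁ + 3 * C₂ + C₃, max (max s₁ s₂) (max s₃ (|e.R| + 1)), by positivity,
    ?_, ?_, fun y hy => ?_⟩
  · have : |e.R| + 1 ≤ max (max s₁ s₂) (max s₃ (|e.R| + 1)) :=
      (le_max_right _ _).trans (le_max_right _ _)
    linarith [abs_nonneg e.R]
  · have : |e.R| + 1 ≤ max (max s₁ s₂) (max s₃ (|e.R| + 1)) :=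
      (le_max_right _ _).trans (le_max_right _ _)
    linarith [le_abs_self e.R]
  have hy₁ : s₁ ≤ ‖y‖ := le_trans (le_max_left _ _) ((le_max_left _ _).trans hy)
  have hy₂ : s₂ ≤ ‖y‖ := le_trans (le_max_right _ _) ((le_max_left _ _).trans hy)
  have hy₃ : s₃ ≤ ‖y‖ := le_trans (le_max_left _ _) ((le_max_right _ _).trans hy)
  have hpow : ∀ s : ℝ, 0 ≤ ‖y‖ ^ s := fun s => Real.rpow_nonneg (norm_nonneg _) _
  have hK₁ : C₁ ≤ 9 * C₁ + 3 * C₂ + C₃ := by linarith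
  have hK₂ : C₂ ≤ 9 * C₁ + 3 * C₂ + C₃ := by linarith
  have hK₃ : C₃ ≤ 9 * C₁ + 3 * C₂ + C₃ := by linarith
  refine ⟨⟨fun k l => ?_, ?_, fun i k l => ?_, fun i j k l => ?_⟩,
    ⟨fun m => (h₂ m y hy₂).1, ?_, fun i m => ?_, fun i i' m => ?_⟩,
    ⟨(h₃ () y hy₃).1, ?_, fun i => ?_, fun i j => ?_⟩⟩
  · -- smoothness of `a`
    have h := (h₁ (k, l) y hy₁).1
    simpa using h.add (contDiffAt_const (c := if k = l then (1 : ℝ) else 0))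
  · -- `Σ |a - δ|`
    have h : ∀ k l, |MetricCoord.ginv (hCoeff e D) b.toBasis y l k - if k = l then 1 else 0|
        ≤ C₁ * ‖y‖ ^ (-2 : ℝ) := fun k l => (h₁ (k, l) y hy₁).2.1
    calc ∑ k, ∑ l, |MetricCoord.ginv (hCoeff e D) b.toBasis y l k - if k = l then 1 else 0|
        ≤ ∑ k : Fin 3, ∑ l : Fin 3, C₁ * ‖y‖ ^ (-2 : ℝ) :=
          Finset.sum_le_sum fun k _ => Finset.sum_le_sum fun l _ => h k l
      _ = 9 * C₁ * ‖y‖ ^ (-2 : ℝ) := by simp; ring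
      _ ≤ (9 * C₁ + 3 * C₂ + C₃) * ‖y‖ ^ (-2 : ℝ) := by
          apply mul_le_mul_of_nonneg_right _ (hpow _); linarith
  · -- `∂a`
    have h := (h₁ (k, l) y hy₁).2.2.1 (b i) (hb1 i)
    have e1 : fderiv ℝ (fun z ↦ MetricCoord.ginv (hCoeff e D) b.toBasis z l k) y =
        fderiv ℝ (fun z ↦ MetricCoord.ginv (hCoeff e D) b.toBasis z l k - if k = l then 1 else 0) y := by
      rw [fderiv_sub_const]
    rw [e1]
    rw [show (-2 : ℝ) - 1 = -3 by norm_num] at h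
    exact h.trans (mul_le_mul_of_nonneg_right hK₁ (hpow _))
  · -- `∂²a`
    have h := (h₁ (k, l) y hy₁).2.2.2 (b i) (b j) (hb1 i) (hb1 j)
    have e1 : (fun z ↦ fderiv ℝ (fun z' ↦ MetricCoord.ginv (hCoeff e D) b.toBasis z' l k) z (b i)) =
        fun z ↦ fderiv ℝ (fun z' ↦ MetricCoord.ginv (hCoeff e D) b.toBasis z' l k
          - if k = l then 1 else 0) z (b i) := by
      funext z; rw [fderiv_sub_const]
    rw [e1]
    rw [show (-2 : ℝ) - 2 = -4 by norm_num] at h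
    exact h.trans (mul_le_mul_of_nonneg_right hK₁ (hpow _))
  · -- `Σ |β|`
    calc ∑ m, |-(2⁻¹ * ∑ k, ∑ l, ∑ j,
          MetricCoord.ginv (hCoeff e D) b.toBasis y k l * MetricCoord.ginv (hCoeff e D) b.toBasis y m j
            * MetricCoord.koszulCLM (hCoeff e D) y (b k) (b l) (b j))|
        ≤ ∑ m : Fin 3, C₂ * ‖y‖ ^ (-3 : ℝ) := Finset.sum_le_sum fun m _ => by
          have := (h₂ m y hy₂).2.1; rwa [show (-2 : ℝ) - 1 = -3 by norm_num] at this
      _ = 3 * C₂ * ‖y‖ ^ (-3 : ℝ) := by simp; ring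
      _ ≤ (9 * C₁ + 3 * C₂ + C₃) * ‖y‖ ^ (-3 : ℝ) := by
          apply mul_le_mul_of_nonneg_right _ (hpow _); linarith
  · have h := (h₂ m y hy₂).2.2.1 (b i) (hb1 i)
    rw [show (-2 : ℝ) - 1 - 1 = -4 by norm_num] at h
    exact h.trans (mul_le_mul_of_nonneg_right hK₂ (hpow _))
  · have h := (h₂ m y hy₂).2.2.2 (b i) (b i') (hb1 i) (hb1 i')
    rw [show (-2 : ℝ) - 1 - 2 = -5 by norm_num] at h
    exact h.trans (mul_le_mul_of_nonneg_right hK₂ (hpow _))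
  · have h := (h₃ () y hy₃).2.1
    rw [show (-2 : ℝ) - 2 = -4 by norm_num] at h
    exact h.trans (mul_le_mul_of_nonneg_right hK₃ (hpow _))
  · have h := (h₃ () y hy₃).2.2.1 (b i) (hb1 i)
    rw [show (-2 : ℝ) - 2 - 1 = -5 by norm_num] at h
    exact h.trans (mul_le_mul_of_nonneg_right hK₃ (hpow _))
  · have h := (h₃ () y hy₃).2.2.2 (b i) (b j) (hb1 i) (hb1 j)
    rw [show (-2 : ℝ) - 2 - 2 = -6 by norm_num] at h
    exact h.trans (mul_le_mul_of_nonneg_right hK₃ (hpow _))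

end AFEnd

end Literature.Geometry.Lorentzian
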